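import Summits.MatrixMultiplication.MatrixMultiplication.Theorems.SoloBlindLTwoSeq

/-!
# H(2) = 2 and the window inequality (K₃)≤2 in all ranks (solo-blind, door I1⁗ / (K₃), s80)

Setting of `SoloBlindLTwoSeq`: `h : ι → G`, `G` abelian of exponent `3`, zero-sum free on the finite index set `S`;
`N_k(τ)` = the number of `k`-subsets of `S` with `h`-sum `τ` (`soloBlindSeqRep h S k τ`).

* `soloBlind_seqRep_two_card_le_two_of_hgood` — THE DIAGONAL LAYER BOUND H(2) = 2: if in addition no sub-sum
  over `S` equals `τ + τ = −τ` (i.e. the sequence `h ∪ {τ}` is still zero-sum free), then `N_2(τ) ≤ 2`.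
  (Two representations with different value pairs are disjoint and unite to a sub-sum `2τ`; one value pair
  `{a, b}` carrying `≥ 3` representations forces both value classes doubled, and they unite to `2a + 2b = 2τ`.)
* `soloBlind_window_two` — THE KRAFT INEQUALITY TRUNCATED AT SIZE 2, ALL RANKS:
  `N_2(τ) + 2·N_1(τ) ≤ 4`, i.e. `Σ_{|T| ≤ 2, h_T = τ} 2^{-|T|} ≤ 1`.
  (`N_1 = m(τ) ≤ 2`; if `τ = h p` occurs, representations avoid `p`, live in `S ∖ p`, which is H-good for `τ`
  (a sub-sum `2τ` plus `p` would be a zero-sum), so `N_2 ≤ 2`; if `τ` occurs twice, any representation `T`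
  gives the zero-sum `T ∪ {p, q}`, so `N_2 = 0`.)
Both are sharp (`(e₀, e₀, e₁)`, `τ = e₀ + e₁`, resp. `(τ, τ)`).
-/

namespace Summit.MatrixMultiplication.MatrixMultiplication.Theorems

open Finset

variable {ι G : Type*} [DecidableEq ι] [AddCommGroup G] [DecidableEq G]

/-- THEOREM H(2) = 2 (all ranks, all lengths).  If `h` is zero-sum free on `S` and no sub-sum over `S` equals
`τ + τ` (`h ∪ {τ}` zero-sum free), then at most TWO 2-subsets of `S` have `h`-sum `τ`. -/
theorem soloBlind_seqRep_two_card_le_two_of_hgood (three : ∀ g : G, g + g + g = 0) (h : ι → G)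
    (S : Finset ι) (zsf : ∀ T ⊆ S, T.Nonempty → ∑ i ∈ T, h i ≠ 0) (τ : G)
    (hgood : ∀ T ⊆ S, ∑ i ∈ T, h i ≠ τ + τ) :
    (soloBlindSeqRep h S 2 τ).card ≤ 2 := by
  set E := soloBlindSeqRep h S 2 τ with hE
  by_cases hempty : E = ∅
  · rw [hempty]; simp
  obtain ⟨T₁, hT₁⟩ := Finset.nonempty_iff_ne_empty.mpr hempty
  obtain ⟨x, y, hxyne, rfl, hxS, hyS, hsum⟩ := soloBlind_mem_seqRep_two hT₁
  -- every representation has the value pair of {x, y}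
  have hall : ∀ T ∈ E, T.image h = ({x, y} : Finset ι).image h := by
    intro T hT
    rcases soloBlind_rep2_image_eq_or_disjoint hT hT₁ with he | hd
    · exact he
    · exfalso
      have hdT : Disjoint T {x, y} := soloBlind_disjoint_of_image_disjoint hd
      obtain ⟨hTS, _, hsumT⟩ := soloBlind_mem_seqRep.mp hT
      obtain ⟨hT₁S, _, hsum₁⟩ := soloBlind_mem_seqRep.mp hT₁
      have h2 : ∑ i ∈ T ∪ {x, y}, h i = τ + τ := by rw [Finset.sum_union hdT, hsumT, hsum₁]
      exact hgood _ (Finset.union_subset hTS hT₁S) h2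
  by_cases hxy : h x = h y
  · -- twin representation: the value pair is the singleton {h x}, at most one representation
    have hsub : E ⊆ E.filter (fun T => T.image h = {h x}) := by
      intro T hT
      rw [Finset.mem_filter]
      refine ⟨hT, ?_⟩
      rw [hall T hT, soloBlind_image_pair, ← hxy, Finset.pair_eq_singleton]
    calc E.card ≤ (E.filter (fun T => T.image h = {h x})).card := Finset.card_le_card hsub
      _ ≤ 1 := soloBlind_rep2_fibre_singleton_le_one three h S zsf τ (h x)
      _ ≤ 2 := by norm_num
  · -- one value pair {h x, h y}: ≤ m(h x) · m(h y), and ≥ 3 would double both classes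
    have hfilt : E.filter (fun T => T.image h = {h x, h y}) = E := by
      apply Finset.filter_true_of_mem
      intro T hT
      rw [hall T hT, soloBlind_image_pair]
    set A := S.filter (fun i => h i = h x) with hA
    set B := S.filter (fun i => h i = h y) with hB
    have hAle : A.card ≤ 2 := soloBlind_valueClass_card_le_two three h S zsf (h x)
    have hBle : B.card ≤ 2 := soloBlind_valueClass_card_le_two three h S zsf (h y)
    have hEle : E.card ≤ A.card * B.card := by
      rw [← hfilt]; exact soloBlind_rep2_fibre_le_mul h S τ hxy
    by_contra hgt
    have h3 : 3 ≤ A.card * B.card := by omega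
    have hA2 : A.card = 2 := by
      rcases Nat.lt_or_ge A.card 2 with hlt | hge
      · interval_cases (A.card) <;> omega
      · omega
    have hB2 : B.card = 2 := by
      rcases Nat.lt_or_ge B.card 2 with hlt | hge
      · interval_cases (B.card) <;> omega
      · omega
    have hdAB : Disjoint A B := by
      rw [hA, hB, Finset.disjoint_filter]
      intro i _ hia hib
      exact hxy (hia.symm.trans hib)
    have hsumA : ∑ i ∈ A, h i = h x + h x := by
      rw [hA, soloBlind_sum_valueClass, ← hA, hA2, two_nsmul]
    have hsumB : ∑ i ∈ B, h i = h y + h y := by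
      rw [hB, soloBlind_sum_valueClass, ← hB, hB2, two_nsmul]
    have hZ : ∑ i ∈ A ∪ B, h i = τ + τ := by
      rw [Finset.sum_union hdAB, hsumA, hsumB, ← hsum]
      abel
    exact hgood _ (Finset.union_subset (Finset.filter_subset _ _) (Finset.filter_subset _ _)) hZ

/-- `N_1(τ)` is the number of indices carrying the value `τ`. -/
theorem soloBlind_seqRep_one_card (h : ι → G) (S : Finset ι) (τ : G) :
    (soloBlindSeqRep h S 1 τ).card = (S.filter (fun i => h i = τ)).card := by
  have hE : soloBlindSeqRep h S 1 τ =
      (S.filter (fun i => h i = τ)).image (fun i => ({i} : Finset ι)) := by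
    ext T
    rw [soloBlind_mem_seqRep, Finset.mem_image]
    constructor
    · rintro ⟨hTS, hcard, hsum⟩
      obtain ⟨i, rfl⟩ := Finset.card_eq_one.mp hcard
      refine ⟨i, Finset.mem_filter.mpr ⟨hTS (Finset.mem_singleton_self i), ?_⟩, rfl⟩
      simpa using hsum
    · rintro ⟨i, hi, rfl⟩
      rw [Finset.mem_filter] at hi
      refine ⟨Finset.singleton_subset_iff.mpr hi.1, Finset.card_singleton i, ?_⟩
      simpa using hi.2
  rw [hE, Finset.card_image_of_injective _ (fun a b hab => Finset.singleton_injective hab)]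

/-- A size-`2` representation of `τ` contains no index with value `τ` (the other index would carry `0`). -/
theorem soloBlind_rep2_avoids_value {h : ι → G} {S : Finset ι}
    (zsf : ∀ T ⊆ S, T.Nonempty → ∑ i ∈ T, h i ≠ 0) {τ : G} {p : ι} (hpτ : h p = τ)
    {T : Finset ι} (hT : T ∈ soloBlindSeqRep h S 2 τ) : p ∉ T := by
  obtain ⟨x, y, hxyne, rfl, hxS, hyS, hsum⟩ := soloBlind_mem_seqRep_two hT
  intro hp
  simp only [Finset.mem_insert, Finset.mem_singleton] at hp
  rcases hp with hpx | hpy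
  · -- p = x : h y = 0
    rw [hpx] at hpτ
    have hy0 : h y = 0 := add_left_cancel (a := h x) (by rw [hsum, hpτ, add_zero])
    exact zsf {y} (Finset.singleton_subset_iff.mpr hyS) (Finset.singleton_nonempty y)
      (by rw [Finset.sum_singleton]; exact hy0)
  · -- p = y : h x = 0
    rw [hpy] at hpτ
    have hx0 : h x = 0 := add_right_cancel (b := h y) (by rw [hsum, hpτ, zero_add])
    exact zsf {x} (Finset.singleton_subset_iff.mpr hxS) (Finset.singleton_nonempty x)
      (by rw [Finset.sum_singleton]; exact hx0)

/-- THEOREM (K₃)≤2 IN ALL RANKS: the Kraft sum of a zero-sum-free sequence truncated at size `2` is at most `1`,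
i.e. `N_2(τ) + 2·N_1(τ) ≤ 4` for every `τ`. -/
theorem soloBlind_window_two (three : ∀ g : G, g + g + g = 0) (h : ι → G) (S : Finset ι)
    (zsf : ∀ T ⊆ S, T.Nonempty → ∑ i ∈ T, h i ≠ 0) (τ : G) :
    (soloBlindSeqRep h S 2 τ).card + 2 * (soloBlindSeqRep h S 1 τ).card ≤ 4 := by
  rw [soloBlind_seqRep_one_card]
  set M := S.filter (fun i => h i = τ) with hM
  have hMle : M.card ≤ 2 := soloBlind_valueClass_card_le_two three h S zsf τ
  have hL2 : (soloBlindSeqRep h S 2 τ).card ≤ 4 := soloBlind_seqRep_two_card_le_four three h S zsf τ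
  have havoid : ∀ T ∈ soloBlindSeqRep h S 2 τ, Disjoint T M := by
    intro T hT
    rw [Finset.disjoint_right]
    intro p hp
    exact soloBlind_rep2_avoids_value zsf (Finset.mem_filter.mp hp).2 hT
  by_cases hM0 : M.card = 0
  · rw [hM0]; omega
  obtain ⟨p, hp⟩ := Finset.card_pos.mp (Nat.pos_of_ne_zero hM0)
  have hpS : p ∈ S := (Finset.mem_filter.mp hp).1
  have hpτ : h p = τ := (Finset.mem_filter.mp hp).2
  -- representations live in S ∖ p, which is H-good for τ
  have hsub : soloBlindSeqRep h S 2 τ ⊆ soloBlindSeqRep h (S.erase p) 2 τ := by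
    intro T hT
    obtain ⟨hTS, hcard, hsumT⟩ := soloBlind_mem_seqRep.mp hT
    rw [soloBlind_mem_seqRep]
    refine ⟨fun z hz => Finset.mem_erase.mpr ⟨?_, hTS hz⟩, hcard, hsumT⟩
    rintro rfl
    exact Finset.disjoint_left.mp (havoid T hT) hz hp
  have hzsf' : ∀ T ⊆ S.erase p, T.Nonempty → ∑ i ∈ T, h i ≠ 0 :=
    fun T hT hne => zsf T (hT.trans (Finset.erase_subset p S)) hne
  have hgood : ∀ T ⊆ S.erase p, ∑ i ∈ T, h i ≠ τ + τ := by
    intro T hT hsumT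
    have hpT : p ∉ T := fun hpT => (Finset.mem_erase.mp (hT hpT)).1 rfl
    have hZ : ∑ i ∈ insert p T, h i = 0 := by
      rw [Finset.sum_insert hpT, hsumT, hpτ, ← add_assoc]; exact three τ
    exact zsf _ (Finset.insert_subset hpS (hT.trans (Finset.erase_subset p S)))
      (Finset.insert_nonempty p T) hZ
  have hN2 : (soloBlindSeqRep h S 2 τ).card ≤ 2 :=
    (Finset.card_le_card hsub).trans
      (soloBlind_seqRep_two_card_le_two_of_hgood three h (S.erase p) hzsf' τ hgood)
  by_cases hM1 : M.card = 1
  · rw [hM1]; omega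
  -- τ occurs twice: every representation T gives the zero-sum T ∪ M (τ + (τ + τ) = 0), so N_2 = 0
  have hM2 : M.card = 2 := by omega
  have hsumM : ∑ i ∈ M, h i = τ + τ := by
    rw [hM, soloBlind_sum_valueClass, ← hM, hM2, two_nsmul]
  have hE0 : (soloBlindSeqRep h S 2 τ).card = 0 := by
    by_contra hne
    obtain ⟨T, hT⟩ := Finset.card_pos.mp (Nat.pos_of_ne_zero hne)
    obtain ⟨hTS, _, hsumT⟩ := soloBlind_mem_seqRep.mp hT
    have hZ : ∑ i ∈ T ∪ M, h i = 0 := by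
      rw [Finset.sum_union (havoid T hT), hsumT, hsumM, ← add_assoc]; exact three τ
    exact zsf _ (Finset.union_subset hTS (Finset.filter_subset _ _))
      ⟨p, Finset.mem_union_right _ hp⟩ hZ
  omega

/-- The same two statements over `𝔽₃^r`. -/
theorem soloBlind_window_two_F3 {r : ℕ} (h : ι → (Fin r → ZMod 3)) (S : Finset ι)
    (zsf : ∀ T ⊆ S, T.Nonempty → ∑ i ∈ T, h i ≠ 0) (τ : Fin r → ZMod 3) :
    (soloBlindSeqRep h S 2 τ).card + 2 * (soloBlindSeqRep h S 1 τ).card ≤ 4 := by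
  refine soloBlind_window_two ?_ h S zsf τ
  intro g
  funext i
  have h3 : ∀ a : ZMod 3, a + a + a = 0 := by decide
  exact h3 (g i)

/-- SHARPNESS of H(2): `h = (e₀, e₀, e₁)` in `𝔽₃²`, `τ = e₀ + e₁`: `h ∪ {τ}` is zero-sum free and `N_2(τ) = 2`. -/
theorem soloBlind_hgood_two_attained :
    let h : Fin 3 → (Fin 2 → ZMod 3) := ![![1, 0], ![1, 0], ![0, 1]]
    (∀ T ⊆ (Finset.univ : Finset (Fin 3)), T.Nonempty → ∑ i ∈ T, h i ≠ 0) ∧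
      (∀ T ⊆ (Finset.univ : Finset (Fin 3)), ∑ i ∈ T, h i ≠ ![1, 1] + ![1, 1]) ∧
      (soloBlindSeqRep h Finset.univ 2 ![1, 1]).card = 2 := by
  refine ⟨?_, ?_, ?_⟩
  · intro T _ hTne
    revert T
    decide
  · intro T _
    revert T
    decide
  · decide

/-- SHARPNESS of the window inequality on the `N_1` side: `h = (τ, τ)` over `𝔽₃`, `N_1 = 2`, `N_2 = 0`. -/
theorem soloBlind_window_two_attained :
    let h : Fin 2 → ZMod 3 := ![1, 1]
    (∀ T ⊆ (Finset.univ : Finset (Fin 2)), T.Nonempty → ∑ i ∈ T, h i ≠ 0) ∧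
      (soloBlindSeqRep h Finset.univ 2 1).card + 2 * (soloBlindSeqRep h Finset.univ 1 1).card = 4 := by
  refine ⟨?_, ?_⟩
  · intro T _ hTne
    revert T
    decide
  · decide

end Summit.MatrixMultiplication.MatrixMultiplication.Theorems
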